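import Mathlib.Data.Set.Card
import Mathlib.Analysis.SpecialFunctions.Pow.Real
import Literature.NumberTheory.LFunctions.RiemannSiegel
import Literature.NumberTheory.LFunctions.RiemannSiegelFacts
import Literature.NumberTheory.LFunctions.RiemannSiegelThetaBounds
import Literature.NumberTheory.LFunctions.RiemannSiegelStirling
import Literature.Barriers.RiemannHypothesis.GramRosserFailuresProofs
import Literature.Analysis.SpecialFunctions.DigammaVerticalSeries
import HarnessLib

/-!
# From counting to displacement — the França–LeClair lattice (`stub_displacementBound`, Aux)

Auxiliary lemmas for the stub `stub_displacementBound` of the line `defect-compactness-design`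
(wave 2, structure of witnesses) for the crux `WindowTraceArch` (stmt-RiemannHypothesis-11195;
skeleton `Summit.RiemannHypothesis.RiemannHypothesis.Cruxes.WindowTraceArch.DefectCompactnessDesign`).

**Statement (landing anchor `stub_displacementBound_lattice`).** Let `p : ℕ → ℝ` be strictly
increasing with `p n ≥ 7` and `θ(p n) = (n − ½)π` (`θ = riemannSiegelTheta`; these are the positive
França–LeClair points `14.52, 20.65, 25.49, …`). Then
* `p m ≤ 100 + 7m` (crude linear growth),
* `θ'(p m) ≥ (log m)/4 − 3` for `m ≥ 1` (`θ' = riemannSiegelThetaDeriv`), and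
* `(p m' − p m) · θ'(p m) ≤ (m' − m)π` for `m ≤ m'` (the gaps shrink like `π/θ' ≍ 2π/log`).

Also recorded: for a non-decreasing `a : ℕ → ℝ` whose sub-level set `{n | a n ≤ T}` is finite,
`a j ≤ T ↔ j < #{n | a n ≤ T}` (the sub-level set is an initial segment of `ℕ`).

**Proof sketch.** `θ(y) − θ(x) = ∫ₓʸ θ'` by definition of `θ`, and `θ'(u) = Re ψ(¼ + iu/2)/2 −
(log π)/2` is non-decreasing in `|u|` (`reDigammaQuarter_mono`), so `(y − x) θ'(x) ≤ θ(y) − θ(x)`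
for `0 ≤ x ≤ y`; with `θ(p m') − θ(p m) = (m' − m)π` this is the gap bound. The explicit Stirling
bound `|θ(t) − (t/2 · log(t/2π) − t/2 − π/8)| ≤ 2K(¼)/t` (`abs_riemannSiegelTheta_sub_stirling_le`,
`2K(¼) ≤ 6/5`) gives `θ(t) ≤ t²` for `t ≥ 7` and `θ(t) ≥ t/2 − 2` for `t ≥ 100`
(`log(t/2π) ≥ 2` there), whence `(m − ½)π ≤ (p m)²` (so `log p m ≥ (log m)/2` for `m ≥ 1`) and
`p m ≤ 100 + 7m`. Finally `θ'(u) ≥ ½ log(u/2π) − 2/u` (`abs_riemannSiegelThetaDeriv_sub_log_le`)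
and `log(2π) ≤ 2π − 1` give `θ'(p m) ≥ (log m)/4 − 3`.

**Sources.** G. França, A. LeClair, *Transcendental equations satisfied by the individual zeros of
Riemann ζ, Dirichlet and modular L-functions*, Commun. Number Theory Phys. 9 (2015), eq. (18)
(arXiv:1502.06003); E. C. Titchmarsh, *The Theory of the Riemann Zeta-Function* (1986), §4.17,
§9.3; H. M. Edwards, *Riemann's Zeta Function* (1974), §6.5. All ingredients are proved tree /
Mathlib facts; the arguments here are elementary. [folklore]
-/

set_option linter.dupNamespace false

noncomputable section

open Set Filter MeasureTheory
open scoped Real Topology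

namespace Summit.RiemannHypothesis.RiemannHypothesis.Theorems.SpectralTraceWindowTraceArch

open Literature.NumberTheory.LFunctions
open Literature.Barriers.RiemannHypothesis
open Literature.Analysis.SpecialFunctions

/-! ## `θ` as the integral of the non-decreasing `θ'` -/

/-- `θ(y) − θ(x) = ∫ₓʸ θ'` (definition of `θ` as `∫₀ᵗ θ'`, additivity of the interval
integral). [folklore] -/
theorem stub_displacementBound_theta_sub (x y : ℝ) :
    riemannSiegelTheta y - riemannSiegelTheta x = ∫ u in x..y, riemannSiegelThetaDeriv u := by
  have hc : Continuous riemannSiegelThetaDeriv := continuous_riemannSiegelThetaDeriv_holds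
  simp only [riemannSiegelTheta]
  exact intervalIntegral.integral_interval_sub_left (hc.intervalIntegrable _ _)
    (hc.intervalIntegrable _ _)

/-- `θ'` is non-decreasing on `[0, ∞)`: `θ'(u) = Re ψ(¼ + iu/2)/2 − (log π)/2` and
`Re ψ(¼ + iu/2)` is increasing in `|u|` (`reDigammaQuarter_mono`). [folklore] -/
theorem stub_displacementBound_thetaDeriv_mono {u v : ℝ} (hu : 0 ≤ u) (huv : u ≤ v) :
    riemannSiegelThetaDeriv u ≤ riemannSiegelThetaDeriv v := by
  have h1 : riemannSiegelThetaDeriv u = reDigammaQuarter u / 2 - Real.log π / 2 := rfl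
  have h2 : riemannSiegelThetaDeriv v = reDigammaQuarter v / 2 - Real.log π / 2 := rfl
  have h3 : reDigammaQuarter u ≤ reDigammaQuarter v :=
    reDigammaQuarter_mono (by rw [abs_of_nonneg hu, abs_of_nonneg (hu.trans huv)]; exact huv)
  rw [h1, h2]
  linarith

/-- **Lower gap inequality**: `(y − x) θ'(x) ≤ θ(y) − θ(x)` for `0 ≤ x ≤ y` (`θ'` is
non-decreasing on `[x, y]`). [folklore] -/
theorem stub_displacementBound_sub_mul_le {x y : ℝ} (hx : 0 ≤ x) (hxy : x ≤ y) :
    (y - x) * riemannSiegelThetaDeriv x ≤ riemannSiegelTheta y - riemannSiegelTheta x := by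
  have hc : Continuous riemannSiegelThetaDeriv := continuous_riemannSiegelThetaDeriv_holds
  rw [stub_displacementBound_theta_sub]
  have h1 : ∫ _ in x..y, riemannSiegelThetaDeriv x = (y - x) * riemannSiegelThetaDeriv x := by
    rw [intervalIntegral.integral_const, smul_eq_mul]
  rw [← h1]
  refine intervalIntegral.integral_mono_on hxy ?_ (hc.intervalIntegrable _ _) ?_
  · exact intervalIntegrable_const
  · intro u hu
    exact stub_displacementBound_thetaDeriv_mono hx hu.1

/-! ## Explicit Stirling consequences -/

/-- The Stirling remainder constant: `2K(¼) ≤ 6/5` (`K(¼) = 1/6 + π/12 + 1/32 + 1/8 = 0.585…`).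
[folklore] -/
theorem stub_displacementBound_two_stirling_le : 2 * stirlingVertRate (1 / 4) ≤ 6 / 5 := by
  have hπ3 : π < 3.15 := Real.pi_lt_d2
  simp only [stirlingVertRate]
  nlinarith

/-- **`θ(t) ≤ t²` for `t ≥ 7`** (Stirling; `log(t/2π) ≤ t/2π − 1 ≤ t/6`). [folklore] -/
theorem stub_displacementBound_theta_le_sq {t : ℝ} (ht : 7 ≤ t) : riemannSiegelTheta t ≤ t ^ 2 := by
  have hπ0 : 3 < π := Real.pi_gt_three
  have ht0 : 0 < t := by linarith
  have h := (abs_le.1 (abs_riemannSiegelTheta_sub_stirling_le (t := t) (by linarith))).2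
  have hK := stub_displacementBound_two_stirling_le
  have hK0 : 0 ≤ 2 * stirlingVertRate (1 / 4) := by
    simp only [stirlingVertRate]; positivity
  have hrem : 2 * stirlingVertRate (1 / 4) / t ≤ 2 * stirlingVertRate (1 / 4) :=
    div_le_self hK0 (by linarith)
  have hlog : Real.log (t / (2 * π)) ≤ t / 6 := by
    have h1 : Real.log (t / (2 * π)) ≤ t / (2 * π) - 1 := Real.log_le_sub_one_of_pos (by positivity)
    have h2 : t / (2 * π) ≤ t / 6 := by
      rw [div_le_div_iff₀ (by positivity) (by norm_num)]
      nlinarith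
    linarith
  have hmain : t / 2 * Real.log (t / (2 * π)) ≤ t / 2 * (t / 6) :=
    mul_le_mul_of_nonneg_left hlog (by positivity)
  nlinarith

/-- **`θ(t) ≥ t/2 − 2` for `t ≥ 100`** (Stirling; `log(t/2π) ≥ 2` as `t/2π ≥ 15 > e²`).
[folklore] -/
theorem stub_displacementBound_theta_ge {t : ℝ} (ht : 100 ≤ t) : t / 2 - 2 ≤ riemannSiegelTheta t := by
  have hπ0 : 3 < π := Real.pi_gt_three
  have hπ3 : π < 3.15 := Real.pi_lt_d2
  have ht0 : 0 < t := by linarith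
  have h := (abs_le.1 (abs_riemannSiegelTheta_sub_stirling_le (t := t) (by linarith))).1
  have hK := stub_displacementBound_two_stirling_le
  have hK0 : 0 ≤ 2 * stirlingVertRate (1 / 4) := by
    simp only [stirlingVertRate]; positivity
  have hrem : 2 * stirlingVertRate (1 / 4) / t ≤ 2 * stirlingVertRate (1 / 4) :=
    div_le_self hK0 (by linarith)
  have he : Real.exp 1 < 2.7182818286 := Real.exp_one_lt_d9
  have he0 : 0 < Real.exp 1 := Real.exp_pos 1
  have hexp2 : Real.exp 2 ≤ t / (2 * π) := by
    have h1 : Real.exp 2 = Real.exp 1 * Real.exp 1 := by rw [← Real.exp_add]; norm_num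
    rw [h1, le_div_iff₀ (by positivity)]
    nlinarith
  have hlog : 2 ≤ Real.log (t / (2 * π)) := by
    have h1 := Real.log_le_log (Real.exp_pos 2) hexp2
    rwa [Real.log_exp] at h1
  have hmain : t / 2 * 2 ≤ t / 2 * Real.log (t / (2 * π)) :=
    mul_le_mul_of_nonneg_left hlog (by positivity)
  nlinarith

/-! ## The lattice `p`: growth, derivative and gaps -/

/-- **Crude linear growth**: `p m ≤ 100 + 7m` (from `θ(p m) = (m − ½)π ≥ p m/2 − 2` when
`p m ≥ 100`, and `2π ≤ 7`). [folklore] -/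
theorem stub_displacementBound_p_le (p : ℕ → ℝ)
    (hθp : ∀ n : ℕ, riemannSiegelTheta (p n) = ((n : ℝ) - 1 / 2) * Real.pi) (m : ℕ) :
    p m ≤ 100 + 7 * m := by
  have hπ3 : π < 3.15 := Real.pi_lt_d2
  have hm0 : (0 : ℝ) ≤ m := Nat.cast_nonneg m
  rcases le_or_gt (p m) 100 with h | h
  · linarith
  · have h1 := stub_displacementBound_theta_ge h.le
    rw [hθp m] at h1
    have h2 : (m : ℝ) * π ≤ (m : ℝ) * 3.15 := mul_le_mul_of_nonneg_left hπ3.le hm0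
    have hπ0 : 0 < π := Real.pi_pos
    nlinarith

/-- **Lower growth**: `(m − ½)π = θ(p m) ≤ (p m)²`, so `log m ≤ 2 log p m` for `m ≥ 1`.
[folklore] -/
theorem stub_displacementBound_log_le (p : ℕ → ℝ) (hp7 : ∀ n, 7 ≤ p n)
    (hθp : ∀ n : ℕ, riemannSiegelTheta (p n) = ((n : ℝ) - 1 / 2) * Real.pi) {m : ℕ} (hm : 1 ≤ m) :
    Real.log m ≤ 2 * Real.log (p m) := by
  have hπ0 : 3 < π := Real.pi_gt_three
  have hm1 : (1 : ℝ) ≤ m := by exact_mod_cast hm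
  have h1 := stub_displacementBound_theta_le_sq (hp7 m)
  rw [hθp m] at h1
  have h2 : (m : ℝ) ≤ p m ^ 2 := by nlinarith
  have h3 := Real.log_le_log (by positivity) h2
  rwa [Real.log_pow, Nat.cast_ofNat] at h3

/-- **`θ'` at the lattice points**: `θ'(p m) ≥ (log m)/4 − 3` for `m ≥ 1`
(`θ'(u) ≥ ½ log(u/2π) − 2/u`, `log(2π) ≤ 2π − 1`, `log p m ≥ (log m)/2`). [folklore] -/
theorem stub_displacementBound_thetaDeriv_p_ge (p : ℕ → ℝ) (hp7 : ∀ n, 7 ≤ p n)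
    (hθp : ∀ n : ℕ, riemannSiegelTheta (p n) = ((n : ℝ) - 1 / 2) * Real.pi) {m : ℕ} (hm : 1 ≤ m) :
    Real.log m / 4 - 3 ≤ riemannSiegelThetaDeriv (p m) := by
  have hπ0 : 3 < π := Real.pi_gt_three
  have hπ3 : π < 3.15 := Real.pi_lt_d2
  have hu7 := hp7 m
  have hu0 : 0 < p m := by linarith
  have h := (abs_le.1 (abs_riemannSiegelThetaDeriv_sub_log_le (u := p m) (by linarith))).1
  have h2u : 2 / p m ≤ 2 / 7 := div_le_div_of_nonneg_left (by norm_num) (by norm_num) hu7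
  have hlog : Real.log (p m / (2 * π)) = Real.log (p m) - Real.log (2 * π) :=
    Real.log_div hu0.ne' (by positivity)
  have hl2π : Real.log (2 * π) ≤ 2 * π - 1 := Real.log_le_sub_one_of_pos (by positivity)
  have hlm := stub_displacementBound_log_le p hp7 hθp hm
  rw [hlog] at h
  linarith

/-- **Gap bound**: `(p m' − p m) θ'(p m) ≤ (m' − m)π` for `m ≤ m'` (`θ(p m') − θ(p m) = (m' − m)π`
and the lower gap inequality). [folklore] -/
theorem stub_displacementBound_p_gap (p : ℕ → ℝ) (hp : StrictMono p) (hp7 : ∀ n, 7 ≤ p n)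
    (hθp : ∀ n : ℕ, riemannSiegelTheta (p n) = ((n : ℝ) - 1 / 2) * Real.pi) {m m' : ℕ}
    (hmm' : m ≤ m') :
    (p m' - p m) * riemannSiegelThetaDeriv (p m) ≤ ((m' : ℝ) - m) * Real.pi := by
  have h := stub_displacementBound_sub_mul_le (x := p m) (y := p m') (by linarith [hp7 m])
    (hp.monotone hmm')
  rw [hθp m, hθp m'] at h
  linarith

/-- **The lattice facts packaged** (landing anchor of this Aux file): linear growth, the
derivative lower bound at lattice points, and the gap bound. [folklore] -/
theorem stub_displacementBound_lattice :
    ∀ p : ℕ → ℝ, StrictMono p → (∀ n, 7 ≤ p n) →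
      (∀ n : ℕ, Literature.NumberTheory.LFunctions.riemannSiegelTheta (p n) = ((n : ℝ) - 1 / 2) * Real.pi) →
      (∀ m : ℕ, p m ≤ 100 + 7 * m) ∧
      (∀ m : ℕ, 1 ≤ m → Real.log m / 4 - 3 ≤ Literature.NumberTheory.LFunctions.riemannSiegelThetaDeriv (p m)) ∧
      (∀ m m' : ℕ, m ≤ m' →
        (p m' - p m) * Literature.NumberTheory.LFunctions.riemannSiegelThetaDeriv (p m) ≤ ((m' : ℝ) - m) * Real.pi) :=
  fun p hp hp7 hθp =>
    ⟨stub_displacementBound_p_le p hθp, fun _ hm => stub_displacementBound_thetaDeriv_p_ge p hp7 hθp hm,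
      fun _ _ hmm' => stub_displacementBound_p_gap p hp hp7 hθp hmm'⟩

/-! ## Sub-level sets of a non-decreasing sequence are initial segments -/

/-- For a non-decreasing `a` with `{n | a n ≤ T}` finite: `a j ≤ T ↔ j < #{n | a n ≤ T}`.
[folklore] -/
theorem stub_displacementBound_le_iff_lt_ncard {a : ℕ → ℝ} (ha : Monotone a) {T : ℝ}
    (hfin : {n : ℕ | a n ≤ T}.Finite) (j : ℕ) :
    a j ≤ T ↔ j < {n : ℕ | a n ≤ T}.ncard := by
  constructor
  · intro hj
    have hsub : Set.Iic j ⊆ {n : ℕ | a n ≤ T} := fun k hk => (ha (Set.mem_Iic.1 hk)).trans hj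
    have h1 := Set.ncard_le_ncard hsub hfin
    have h2 : (Set.Iic j).ncard = j + 1 := by
      rw [← Finset.coe_Iic, Set.ncard_coe_finset, Nat.card_Iic]
    omega
  · intro hj
    by_contra hjT
    have hsub : {n : ℕ | a n ≤ T} ⊆ Set.Iio j := by
      intro k hk
      rw [Set.mem_Iio]
      by_contra hkj
      exact hjT ((ha (not_lt.1 hkj)).trans hk)
    have h1 := Set.ncard_le_ncard hsub (Set.finite_Iio j)
    have h2 : (Set.Iio j).ncard = j := by
      rw [← Finset.coe_Iio, Set.ncard_coe_finset, Nat.card_Iio]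
    omega

end Summit.RiemannHypothesis.RiemannHypothesis.Theorems.SpectralTraceWindowTraceArch

end
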